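import Literature.NumberTheory.LFunctions.GRHCharacterPrimeSumsProofs
import HarnessLib

/-!
# Twisted prime sums under GRH, I: damped sums over zeros in shifted windows

Topic `Literature/NumberTheory/LFunctions`. THEOREMS (everything proved). First support file of
the GRH bound for the *twisted* Chebyshev function
`ψ(x, χ, t) = ∑_{n ≤ x} χ(n) Λ(n) n^{-it}` of a primitive character `χ` mod `q > 1`
(`GRHTwistedCharacterPrimeSums.lean`), the input of Lagarias–Soundararajan's Lindelöf-on-average
bound for the partial Euler products `L(s, χ; y)` under GRH.

For a non-trivial zero `ρ = 1/2 + iγ` (RH) put `w = ρ − it`, so `|w| ≍ 1 + |γ − t|`. The zeros of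
`L(s, χ)` with `|γ| ≤ T` are grouped in the unit windows `|γ − (t ± k)| ≤ 1/2`, `k ∈ ℕ`, each of
total multiplicity `≪ log q(|t| + k + 4)` (Montgomery–Vaughan Thm. 10.17, the tree's
`Literature.NumberTheory.LFunctions.ExplicitPsiChar.exists_sum_window_le`). Against the DAMPED
weight `min(1/|w|, 1/(h|w|²))`, `0 < h ≤ 1`, the window sum is
`≪ (log q + log(2|t| + T + 5)) (1 + log(1 + 1/h))` (`exists_sum_mul_min_le`): harmonic up to
`k ≈ 1/h`, convergent beyond. This is the estimate `∑_ρ (1 + |γ − t|)^{-2} ≪ log q(|t| + 2)` of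
Montgomery–Vaughan (10.29)/(12.5) interpolated with the plain harmonic sum of their proof of
Theorem 13.7; it is what makes ONE factor `log q(|t| + 2)` (instead of two) appear in the bound
for `ψ(x, χ, t)` once the endpoints of the Abel summation are averaged
(`GRHTwistedCharacterPrimeSums.lean`). The averaging produces the integrals
`(b − a)⁻¹ ∫_a^b y^w/w dy`, computed and bounded here (`norm_avg_cpow_div_le_min`).

## References

* H. L. Montgomery, R. C. Vaughan, *Multiplicative Number Theory I. Classical Theory*, CUP 2007,
  Theorem 10.17, Lemma 12.8 ((12.5)), proof of Theorem 13.7. [MontgomeryVaughan2007]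
-/

noncomputable section

open Complex Filter Topology Set Finset MeasureTheory
open scoped Real

namespace Literature.NumberTheory.LFunctions

namespace GRHTwistedPrimeSum

open DirichletCharacter ExplicitPsiChar GRHPrimeCharSum

/-! ### Zeros in a window shifted by `t` -/

/-- On the critical line, a zero in the unit window around the ordinate `t ± n` has
`1/|ρ − it| ≤ 4/(n + 1)`. [folklore] -/
theorem inv_norm_sub_le_of_window {ρ : ℂ} {t n : ℝ} (hn : 0 ≤ n) (hre : ρ.re = 1 / 2)
    (him : n - 1 / 2 ≤ |ρ.im - t|) : 1 / ‖ρ - t * I‖ ≤ 4 / (n + 1) := by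
  have hre' : (ρ - t * I).re = 1 / 2 := by simp [hre]
  have him' : n - 1 / 2 ≤ |(ρ - t * I).im| := by simpa using him
  exact inv_norm_le_of_window hn hre' him'

/-- `|ρ − it| ≥ 1/2` on the critical line. [folklore] -/
theorem half_le_norm_sub {ρ : ℂ} (t : ℝ) (hre : ρ.re = 1 / 2) : 1 / 2 ≤ ‖ρ - t * I‖ := by
  have h := Complex.abs_re_le_norm (ρ - t * I)
  have hre' : (ρ - t * I).re = 1 / 2 := by simp [hre]
  rwa [hre', abs_of_pos (by norm_num : (0 : ℝ) < 1 / 2)] at h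

/-! ### The elementary sums over the windows -/

/-- `∑_{M ≤ k < N} 1/(k + 1)² ≤ 1/M − 1/N` for `1 ≤ M ≤ N` (telescoping
`1/(k + 1)² ≤ 1/k − 1/(k + 1)`). [folklore] -/
theorem sum_Ico_one_div_sq_le {M N : ℕ} (hM : 1 ≤ M) (hMN : M ≤ N) :
    ∑ k ∈ Finset.Ico M N, 1 / ((k : ℝ) + 1) ^ 2 ≤ 1 / (M : ℝ) - 1 / (N : ℝ) := by
  induction N, hMN using Nat.le_induction with
  | base => simp
  | succ N hMN ih =>
    rw [Finset.sum_Ico_succ_top hMN]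
    have hN0 : (0 : ℝ) < N := by exact_mod_cast (show 0 < N by omega)
    have hkey : 1 / ((N : ℝ) + 1) ^ 2 ≤ 1 / (N : ℝ) - 1 / ((N : ℝ) + 1) := by
      rw [div_sub_div _ _ hN0.ne' (by positivity), div_le_div_iff₀ (by positivity) (by positivity)]
      nlinarith
    push_cast
    linarith

/-- The damped window weights sum to `≪ 1 + log(1 + 1/h)`:
`∑_{k < N} min(4/(k+1), 16/(h (k+1)²)) ≤ 20 (1 + log(1 + 1/h))` for `0 < h ≤ 1` (harmonic sum up
to `⌈1/h⌉`, telescoping beyond). [folklore] -/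
theorem sum_range_min_le {h : ℝ} (hh : 0 < h) (hh1 : h ≤ 1) (N : ℕ) :
    ∑ k ∈ Finset.range N, min (4 / ((k : ℝ) + 1)) (16 / (h * ((k : ℝ) + 1) ^ 2)) ≤
      20 * (1 + Real.log (1 + 1 / h)) := by
  set M : ℕ := ⌈1 / h⌉₊ with hMdef
  have hh' : 1 ≤ 1 / h := by rw [le_div_iff₀ hh]; linarith
  have hM1 : 1 ≤ M := Nat.one_le_iff_ne_zero.2 (Nat.pos_iff_ne_zero.1 (Nat.ceil_pos.2 (by linarith)))
  have hM0 : (0 : ℝ) < M := by exact_mod_cast hM1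
  have hMle : (M : ℝ) < 1 / h + 1 := Nat.ceil_lt_add_one (by linarith)
  have hMge : 1 / h ≤ (M : ℝ) := Nat.le_ceil _
  have hlog0 : 0 ≤ Real.log (1 + 1 / h) := Real.log_nonneg (by linarith)
  set f : ℕ → ℝ := fun k ↦ min (4 / ((k : ℝ) + 1)) (16 / (h * ((k : ℝ) + 1) ^ 2)) with hf
  have hf0 : ∀ k, 0 ≤ f k := fun k ↦ le_min (by positivity) (by positivity)
  -- split the range at `M`
  have hsub : Finset.range N ⊆ Finset.range M ∪ Finset.Ico M (max M N) := by
    intro k hk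
    rw [Finset.mem_range] at hk
    rw [Finset.mem_union, Finset.mem_range, Finset.mem_Ico]
    rcases lt_or_ge k M with h | h
    · exact Or.inl h
    · exact Or.inr ⟨h, lt_max_of_lt_right hk⟩
  have hdisj : Disjoint (Finset.range M) (Finset.Ico M (max M N)) := by
    rw [Finset.disjoint_left]
    intro k hk1 hk2
    rw [Finset.mem_range] at hk1
    rw [Finset.mem_Ico] at hk2
    omega
  -- the harmonic sum `∑_{k < M} 1/(k + 1) = H_M ≤ 1 + log M` (Mathlib `harmonic_le_one_add_log`)
  have hharm : ∑ k ∈ Finset.range M, 1 / ((k : ℝ) + 1) ≤ 1 + Real.log M := by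
    have e : ∑ k ∈ Finset.range M, 1 / ((k : ℝ) + 1) = (harmonic M : ℝ) := by
      rw [harmonic]; push_cast
      exact Finset.sum_congr rfl fun n _ ↦ by rw [one_div]
    rw [e]
    exact harmonic_le_one_add_log M
  have h1 : ∑ k ∈ Finset.range M, f k ≤ 4 * (1 + Real.log (1 + 1 / h)) := by
    calc ∑ k ∈ Finset.range M, f k ≤ ∑ k ∈ Finset.range M, 4 * (1 / ((k : ℝ) + 1)) :=
          Finset.sum_le_sum fun k _ ↦ (min_le_left _ _).trans (by rw [← mul_one_div])
      _ = 4 * ∑ k ∈ Finset.range M, 1 / ((k : ℝ) + 1) := by rw [Finset.mul_sum]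
      _ ≤ 4 * (1 + Real.log M) := mul_le_mul_of_nonneg_left hharm (by norm_num)
      _ ≤ 4 * (1 + Real.log (1 + 1 / h)) := by
          have : Real.log M ≤ Real.log (1 + 1 / h) := Real.log_le_log hM0 (by linarith)
          linarith
  have h2 : ∑ k ∈ Finset.Ico M (max M N), f k ≤ 16 := by
    calc ∑ k ∈ Finset.Ico M (max M N), f k
        ≤ ∑ k ∈ Finset.Ico M (max M N), 16 / h * (1 / ((k : ℝ) + 1) ^ 2) :=
          Finset.sum_le_sum fun k _ ↦ (min_le_right _ _).trans (by rw [div_mul_div_comm, mul_one])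
      _ = 16 / h * ∑ k ∈ Finset.Ico M (max M N), 1 / ((k : ℝ) + 1) ^ 2 := by rw [Finset.mul_sum]
      _ ≤ 16 / h * (1 / (M : ℝ) - 1 / ((max M N : ℕ) : ℝ)) :=
          mul_le_mul_of_nonneg_left (sum_Ico_one_div_sq_le hM1 (le_max_left _ _)) (by positivity)
      _ ≤ 16 / h * h := by
          refine mul_le_mul_of_nonneg_left ?_ (by positivity)
          have h3 : 1 / (M : ℝ) ≤ h := by
            rw [div_le_iff₀ hM0]
            calc (1 : ℝ) = 1 / h * h := by field_simp
              _ ≤ M * h := mul_le_mul_of_nonneg_right hMge hh.le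
              _ = h * M := mul_comm _ _
          have h4 : 0 ≤ 1 / ((max M N : ℕ) : ℝ) := by positivity
          linarith
      _ = 16 := by field_simp
  calc ∑ k ∈ Finset.range N, f k ≤ ∑ k ∈ Finset.range M ∪ Finset.Ico M (max M N), f k :=
        Finset.sum_le_sum_of_subset_of_nonneg hsub fun k _ _ ↦ hf0 k
    _ = ∑ k ∈ Finset.range M, f k + ∑ k ∈ Finset.Ico M (max M N), f k := Finset.sum_union hdisj
    _ ≤ 4 * (1 + Real.log (1 + 1 / h)) + 16 := add_le_add h1 h2
    _ ≤ 20 * (1 + Real.log (1 + 1 / h)) := by nlinarith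

/-! ### The damped sum over the zeros -/

/-- **Damped sums over zeros in shifted windows, under RH.** There is an absolute `C₂ > 0` such
that for every `q > 1`, every primitive `χ` mod `q` whose `L`-function satisfies the Riemann
hypothesis, all real `t`, `T ≥ 0`, `0 < h ≤ 1` and every finite set `P` of non-trivial zeros `ρ`
of `L(s, χ)` with `|Im ρ| ≤ T`,
`∑_{ρ ∈ P} m(ρ) min(1/|ρ − it|, 1/(h |ρ − it|²)) ≤ C₂ (log q + log(2|t| + T + 5)) (1 + log(1 + 1/h))`
(windows `||Im ρ − t| − k| ≤ 1/2`, each of total multiplicity `≪ log q(|t| + k + 4)` by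
MV Theorem 10.17, with `1/|ρ − it| ≤ 4/(k + 1)` on the window; then `sum_range_min_le`).
[cite: MontgomeryVaughan2007, Theorem 10.17 and Lemma 12.8 (12.5)] -/
theorem exists_sum_mul_min_le :
    ∃ C₂ : ℝ, 0 < C₂ ∧ ∀ (q : ℕ) [NeZero q] (χ : DirichletCharacter ℂ q), χ.IsPrimitive → 1 < q →
      χ.RiemannHypothesis → ∀ (t T h : ℝ), 0 ≤ T → 0 < h → h ≤ 1 → ∀ P : Finset ℂ,
        (∀ ρ ∈ P, χ.LFunction ρ = 0 ∧ 0 < ρ.re ∧ ρ.re < 1 ∧ |ρ.im| ≤ T) →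
        ∑ ρ ∈ P, (DirichletDisc.zeroOrder χ ρ : ℝ) *
            min (1 / ‖ρ - t * I‖) (1 / (h * ‖ρ - t * I‖ ^ 2)) ≤
          C₂ * (Real.log q + Real.log (2 * |t| + T + 5)) * (1 + Real.log (1 + 1 / h)) := by
  obtain ⟨C, hC0, hC⟩ := ExplicitPsiChar.exists_sum_window_le
  refine ⟨40 * C, by positivity, fun q _ χ hprim hq hRH t T h hT hh hh1 P hP ↦ ?_⟩
  classical
  -- the index `k = ⌊|Im ρ - t| + 1/2⌋` of the shifted unit window containing `ρ`
  set g : ℂ → ℕ := fun ρ ↦ ⌊|ρ.im - t| + 1 / 2⌋₊ with hg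
  have hgwin : ∀ ρ : ℂ, |(|ρ.im - t|) - g ρ| ≤ 1 / 2 := by
    intro ρ
    have h0 : 0 ≤ |ρ.im - t| + 1 / 2 := by positivity
    have h1 : ((⌊|ρ.im - t| + 1 / 2⌋₊ : ℕ) : ℝ) ≤ |ρ.im - t| + 1 / 2 := Nat.floor_le h0
    have h2 : |ρ.im - t| + 1 / 2 < ((⌊|ρ.im - t| + 1 / 2⌋₊ : ℕ) : ℝ) + 1 := Nat.lt_floor_add_one _
    rw [abs_le]
    constructor <;> linarith
  set N : ℕ := ⌊T + |t|⌋₊ + 2 with hN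
  have hTt : 0 ≤ T + |t| := by positivity
  have hTfl : (⌊T + |t|⌋₊ : ℝ) ≤ T + |t| := Nat.floor_le hTt
  have hmaps : ∀ ρ ∈ P, g ρ ∈ Finset.range N := by
    intro ρ hρ
    have h4 := (hP ρ hρ).2.2.2
    have h5 : |ρ.im - t| ≤ T + |t| := (abs_sub _ _).trans (by linarith)
    have h1 : ((⌊|ρ.im - t| + 1 / 2⌋₊ : ℕ) : ℝ) ≤ |ρ.im - t| + 1 / 2 := Nat.floor_le (by positivity)
    have h3 : T + |t| < (⌊T + |t|⌋₊ : ℝ) + 1 := Nat.lt_floor_add_one _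
    have : ((g ρ : ℕ) : ℝ) < (N : ℝ) := by
      rw [hN]; push_cast; linarith
    exact Finset.mem_range.2 (by exact_mod_cast this)
  rw [← Finset.sum_fiberwise_of_maps_to hmaps]
  have hq1 : (1 : ℝ) ≤ q := by exact_mod_cast hq.le
  have hlogq : 0 ≤ Real.log q := Real.log_nonneg hq1
  set ℒ : ℝ := Real.log q + Real.log (2 * |t| + T + 5) with hℒ
  have hlog5 : 0 ≤ Real.log (2 * |t| + T + 5) := Real.log_nonneg (by linarith [abs_nonneg t])
  have hℒ0 : 0 ≤ ℒ := by positivity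
  -- bound on each window
  have hfib : ∀ k ∈ Finset.range N,
      ∑ ρ ∈ P with g ρ = k, (DirichletDisc.zeroOrder χ ρ : ℝ) *
          min (1 / ‖ρ - t * I‖) (1 / (h * ‖ρ - t * I‖ ^ 2)) ≤
        2 * C * ℒ * min (4 / ((k : ℝ) + 1)) (16 / (h * ((k : ℝ) + 1) ^ 2)) := by
    intro k hk
    have hkN : (k : ℝ) + |t| + 4 ≤ 2 * |t| + T + 5 := by
      have hk' : k ≤ ⌊T + |t|⌋₊ + 1 := by
        have := Finset.mem_range.1 hk; omega
      have : (k : ℝ) ≤ ⌊T + |t|⌋₊ + 1 := by exact_mod_cast hk'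
      linarith
    set B : ℝ := min (4 / ((k : ℝ) + 1)) (16 / (h * ((k : ℝ) + 1) ^ 2)) with hB
    have hB0 : 0 ≤ B := le_min (by positivity) (by positivity)
    -- pointwise `m(ρ) min(…) ≤ B · m(ρ)` on the window
    have hptw : ∀ ρ ∈ P.filter (fun ρ ↦ g ρ = k),
        (DirichletDisc.zeroOrder χ ρ : ℝ) * min (1 / ‖ρ - t * I‖) (1 / (h * ‖ρ - t * I‖ ^ 2)) ≤
          B * (DirichletDisc.zeroOrder χ ρ : ℝ) := by
      intro ρ hρ
      rw [Finset.mem_filter] at hρ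
      obtain ⟨h0, h1, h2, -⟩ := hP ρ hρ.1
      have hre : ρ.re = 1 / 2 := hRH ρ h0 h1 h2
      have hw := hgwin ρ
      rw [hρ.2] at hw
      have him : (k : ℝ) - 1 / 2 ≤ |ρ.im - t| := by
        rw [abs_le] at hw; linarith [hw.1]
      have hinv := inv_norm_sub_le_of_window (Nat.cast_nonneg k) hre him
      have hpos : 0 < ‖ρ - t * I‖ := lt_of_lt_of_le (by norm_num) (half_le_norm_sub t hre)
      have hinv0 : 0 ≤ 1 / ‖ρ - t * I‖ := by positivity
      have hsq : 1 / (h * ‖ρ - t * I‖ ^ 2) ≤ 16 / (h * ((k : ℝ) + 1) ^ 2) := by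
        have e1 : 1 / (h * ‖ρ - t * I‖ ^ 2) = 1 / h * (1 / ‖ρ - t * I‖) ^ 2 := by
          field_simp
        have e2 : 16 / (h * ((k : ℝ) + 1) ^ 2) = 1 / h * (4 / ((k : ℝ) + 1)) ^ 2 := by
          field_simp; ring
        rw [e1, e2]
        exact mul_le_mul_of_nonneg_left (pow_le_pow_left₀ hinv0 hinv 2) (by positivity)
      have hmin : min (1 / ‖ρ - t * I‖) (1 / (h * ‖ρ - t * I‖ ^ 2)) ≤ B := min_le_min hinv hsq
      rw [mul_comm]
      exact mul_le_mul_of_nonneg_right hmin (Nat.cast_nonneg _)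
    -- the two windows at `τ = t + k` (`Im ρ ≥ t`) and `τ = t - k` (`Im ρ < t`)
    have hwin_pos : ∑ ρ ∈ (P.filter (fun ρ ↦ g ρ = k)).filter (fun ρ ↦ t ≤ ρ.im),
        (DirichletDisc.zeroOrder χ ρ : ℝ) ≤ C * (Real.log q + Real.log (|t + k| + 4)) := by
      refine hC q χ hprim hq (t + k) _ (fun ρ hρ ↦ ?_)
      rw [Finset.mem_filter, Finset.mem_filter] at hρ
      obtain ⟨⟨hρP, hρn⟩, him⟩ := hρ
      obtain ⟨h0, h1, h2, -⟩ := hP ρ hρP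
      refine ⟨h0, h1, h2, ?_⟩
      have hw := hgwin ρ
      rw [hρn, abs_of_nonneg (sub_nonneg.2 him)] at hw
      rwa [show ρ.im - (t + k) = ρ.im - t - k by ring]
    have hwin_neg : ∑ ρ ∈ (P.filter (fun ρ ↦ g ρ = k)).filter (fun ρ ↦ ¬t ≤ ρ.im),
        (DirichletDisc.zeroOrder χ ρ : ℝ) ≤ C * (Real.log q + Real.log (|t - k| + 4)) := by
      refine hC q χ hprim hq (t - k) _ (fun ρ hρ ↦ ?_)
      rw [Finset.mem_filter, Finset.mem_filter] at hρ
      obtain ⟨⟨hρP, hρn⟩, him⟩ := hρ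
      obtain ⟨h0, h1, h2, -⟩ := hP ρ hρP
      refine ⟨h0, h1, h2, ?_⟩
      have hw := hgwin ρ
      rw [hρn, abs_of_neg (sub_neg.2 (not_le.mp him))] at hw
      rwa [show ρ.im - (t - k) = -(-(ρ.im - t) - k) by ring, abs_neg]
    have hlog1 : Real.log (|t + k| + 4) ≤ Real.log (2 * |t| + T + 5) := by
      refine Real.log_le_log (by positivity) ?_
      have : |t + k| ≤ |t| + k := (abs_add_le _ _).trans (by rw [Nat.abs_cast])
      linarith
    have hlog2 : Real.log (|t - k| + 4) ≤ Real.log (2 * |t| + T + 5) := by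
      refine Real.log_le_log (by positivity) ?_
      have : |t - k| ≤ |t| + k := (abs_sub _ _).trans (by rw [Nat.abs_cast])
      linarith
    calc ∑ ρ ∈ P with g ρ = k, (DirichletDisc.zeroOrder χ ρ : ℝ) *
            min (1 / ‖ρ - t * I‖) (1 / (h * ‖ρ - t * I‖ ^ 2))
        ≤ ∑ ρ ∈ P with g ρ = k, B * (DirichletDisc.zeroOrder χ ρ : ℝ) := Finset.sum_le_sum hptw
      _ = B * ∑ ρ ∈ P with g ρ = k, (DirichletDisc.zeroOrder χ ρ : ℝ) := by rw [Finset.mul_sum]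
      _ = B * (∑ ρ ∈ (P.filter (fun ρ ↦ g ρ = k)).filter (fun ρ ↦ t ≤ ρ.im),
                (DirichletDisc.zeroOrder χ ρ : ℝ) +
              ∑ ρ ∈ (P.filter (fun ρ ↦ g ρ = k)).filter (fun ρ ↦ ¬t ≤ ρ.im),
                (DirichletDisc.zeroOrder χ ρ : ℝ)) := by
          rw [Finset.sum_filter_add_sum_filter_not]
      _ ≤ B * (2 * (C * ℒ)) := by
          refine mul_le_mul_of_nonneg_left ?_ hB0
          have e1 : C * (Real.log q + Real.log (|t + k| + 4)) ≤ C * ℒ :=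
            mul_le_mul_of_nonneg_left (by rw [hℒ]; linarith) hC0.le
          have e2 : C * (Real.log q + Real.log (|t - k| + 4)) ≤ C * ℒ :=
            mul_le_mul_of_nonneg_left (by rw [hℒ]; linarith) hC0.le
          linarith
      _ = 2 * C * ℒ * B := by ring
  have hK0 : 0 ≤ 2 * C * ℒ := by positivity
  calc ∑ k ∈ Finset.range N, ∑ ρ ∈ P with g ρ = k, (DirichletDisc.zeroOrder χ ρ : ℝ) *
          min (1 / ‖ρ - t * I‖) (1 / (h * ‖ρ - t * I‖ ^ 2))
      ≤ ∑ k ∈ Finset.range N, 2 * C * ℒ * min (4 / ((k : ℝ) + 1)) (16 / (h * ((k : ℝ) + 1) ^ 2)) :=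
        Finset.sum_le_sum hfib
    _ = 2 * C * ℒ * ∑ k ∈ Finset.range N, min (4 / ((k : ℝ) + 1)) (16 / (h * ((k : ℝ) + 1) ^ 2)) := by
        rw [Finset.mul_sum]
    _ ≤ 2 * C * ℒ * (20 * (1 + Real.log (1 + 1 / h))) :=
        mul_le_mul_of_nonneg_left (sum_range_min_le hh hh1 N) hK0
    _ = 40 * C * ℒ * (1 + Real.log (1 + 1 / h)) := by ring

/-! ### Averages of `y^w / w` -/

/-- `∫_a^b y^w/w dy = (b^{w+1} − a^{w+1})/((w + 1) w)` for `0 < a ≤ b`, `w ≠ −1`. [folklore] -/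
theorem integral_cpow_div {a b : ℝ} (ha : 0 < a) (hab : a ≤ b) {w : ℂ} (hw1 : w + 1 ≠ 0) :
    ∫ y in a..b, (y : ℂ) ^ w / w = ((b : ℂ) ^ (w + 1) - (a : ℂ) ^ (w + 1)) / ((w + 1) * w) := by
  rw [intervalIntegral.integral_div, integral_cpow, div_div]
  right
  refine ⟨fun h ↦ hw1 (by rw [h]; ring), ?_⟩
  rw [Set.uIcc_of_le hab]
  exact fun h ↦ lt_irrefl (0 : ℝ) (lt_of_lt_of_le ha h.1)

/-- On the critical line (`Re w = 1/2`): `w ≠ 0`, `w + 1 ≠ 0`, `|w + 1| ≥ |w|`. [folklore] -/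
theorem norm_le_norm_add_one {w : ℂ} (hw : w.re = 1 / 2) :
    w ≠ 0 ∧ w + 1 ≠ 0 ∧ ‖w‖ ≤ ‖w + 1‖ := by
  refine ⟨fun h ↦ by rw [h, zero_re] at hw; norm_num at hw,
    fun h ↦ by have := congrArg Complex.re h; simp [hw] at this; norm_num at this, ?_⟩
  rw [← sq_le_sq₀ (norm_nonneg _) (norm_nonneg _), Complex.sq_norm, Complex.sq_norm,
    Complex.normSq_apply, Complex.normSq_apply]
  simp only [add_re, one_re, add_im, one_im, add_zero, hw]
  nlinarith [sq_nonneg w.im]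

/-- **The averaged zero term.** For `Re w = 1/2` and `0 < a < b`:
`‖(b − a)⁻¹ ∫_a^b y^w/w dy‖ ≤ min(b^{1/2}/|w|, 2 b^{3/2}/((b − a)|w|²))` — the trivial bound
(`|y^w/w| ≤ b^{1/2}/|w|`) and the integrated one (`|b^{w+1}|, |a^{w+1}| ≤ b^{3/2}`,
`|w + 1| ≥ |w|`). [folklore] -/
theorem norm_avg_cpow_div_le_min {a b : ℝ} (ha : 0 < a) (hab : a < b) {w : ℂ} (hw : w.re = 1 / 2) :
    ‖((b - a)⁻¹ : ℝ) * ∫ y in a..b, (y : ℂ) ^ w / w‖ ≤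
      min (b ^ (1 / 2 : ℝ) / ‖w‖) (2 * b ^ (3 / 2 : ℝ) / ((b - a) * ‖w‖ ^ 2)) := by
  obtain ⟨hw0, hw1, hww⟩ := norm_le_norm_add_one hw
  have hb : 0 < b := ha.trans hab
  have hba : 0 < b - a := sub_pos.2 hab
  have hnw : 0 < ‖w‖ := norm_pos_iff.2 hw0
  have hnorm : ‖(((b - a)⁻¹ : ℝ) : ℂ)‖ = (b - a)⁻¹ := by
    rw [Complex.norm_real, Real.norm_of_nonneg (inv_nonneg.2 hba.le)]
  rw [norm_mul, hnorm]
  refine le_min ?_ ?_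
  · -- trivial bound
    have h1 : ‖∫ y in a..b, (y : ℂ) ^ w / w‖ ≤ b ^ (1 / 2 : ℝ) / ‖w‖ * |b - a| := by
      refine intervalIntegral.norm_integral_le_of_norm_le_const fun y hy ↦ ?_
      rw [Set.uIoc_of_le hab.le] at hy
      have hy0 : 0 < y := ha.trans hy.1
      rw [norm_div, Complex.norm_cpow_eq_rpow_re_of_pos hy0, hw]
      exact div_le_div_of_nonneg_right (Real.rpow_le_rpow hy0.le hy.2 (by norm_num)) hnw.le
    rw [abs_of_pos hba] at h1
    calc (b - a)⁻¹ * ‖∫ y in a..b, (y : ℂ) ^ w / w‖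
        ≤ (b - a)⁻¹ * (b ^ (1 / 2 : ℝ) / ‖w‖ * (b - a)) :=
          mul_le_mul_of_nonneg_left h1 (inv_nonneg.2 hba.le)
      _ = b ^ (1 / 2 : ℝ) / ‖w‖ := by field_simp
  · -- integrated bound
    rw [integral_cpow_div ha hab.le hw1, norm_div, norm_mul]
    have hre1 : (w + 1).re = 3 / 2 := by simp [hw]; norm_num
    have hbw : ‖(b : ℂ) ^ (w + 1)‖ = b ^ (3 / 2 : ℝ) := by
      rw [Complex.norm_cpow_eq_rpow_re_of_pos hb, hre1]
    have haw : ‖(a : ℂ) ^ (w + 1)‖ ≤ b ^ (3 / 2 : ℝ) := by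
      rw [Complex.norm_cpow_eq_rpow_re_of_pos ha, hre1]
      exact Real.rpow_le_rpow ha.le hab.le (by norm_num)
    have hnum : ‖(b : ℂ) ^ (w + 1) - (a : ℂ) ^ (w + 1)‖ ≤ 2 * b ^ (3 / 2 : ℝ) :=
      calc _ ≤ ‖(b : ℂ) ^ (w + 1)‖ + ‖(a : ℂ) ^ (w + 1)‖ := norm_sub_le _ _
        _ ≤ 2 * b ^ (3 / 2 : ℝ) := by rw [hbw]; linarith
    have hden : ‖w‖ ^ 2 ≤ ‖w + 1‖ * ‖w‖ := by
      rw [sq]; exact mul_le_mul_of_nonneg_right hww hnw.le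
    have hden0 : 0 < ‖w‖ ^ 2 := by positivity
    calc (b - a)⁻¹ * (‖(b : ℂ) ^ (w + 1) - (a : ℂ) ^ (w + 1)‖ / (‖w + 1‖ * ‖w‖))
        ≤ (b - a)⁻¹ * (2 * b ^ (3 / 2 : ℝ) / ‖w‖ ^ 2) := by
          refine mul_le_mul_of_nonneg_left ?_ (inv_nonneg.2 hba.le)
          exact div_le_div₀ (by positivity) hnum hden0 hden
      _ = 2 * b ^ (3 / 2 : ℝ) / ((b - a) * ‖w‖ ^ 2) := by
          field_simp

end GRHTwistedPrimeSum

end Literature.NumberTheory.LFunctions
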